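import Literature.AlgebraicGeometry.HodgeTheory.DworkSexticPencilHodgeLociOfGriffiths
import Mathlib.Analysis.Analytic.IsolatedZeros
import Mathlib.Analysis.Convex.Topology
import HarnessLib

/-!
# Voisin II Lemma 5.13 from Griffiths' theorem: for every smooth projective family over a smooth
# quasi-projective base, the loci `{s : ξ|_{𝒳_s} ∈ Fʳ}` of tube classes are CLOSED

Family `hodge`, layer `Literature/AlgebraicGeometry/HodgeTheory`; proof file (theorems only, no definition,
no named fact). General companion of `DworkSexticPencilHodgeLociOfGriffiths` (the accumulation dichotomy on
the Dwork CURVE): here the base has any dimension `d` and the conclusion is closedness.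

Voisin, *Hodge Theory II*, §5.3.1, Def. 5.12 / Lemma 5.13: "the sets `U_λ^p` [of points where the flat
section `λ` lies in `F^pH^k`] are analytic subsets of `U`" — in particular CLOSED in the ball `U` — "as
`F^p𝓗^k` is a holomorphic subbundle". On the tree's carriers: for a smooth projective family `f : 𝒳 → S`
of relative dimension `n` over a smooth quasi-projective `S` of dimension `d`, an open `B ⊆ S(ℂ)`, a tube
class `ξ ∈ Hᵏ(f⁻¹B(ℂ); ℂ)` (whose restrictions are the flat sections over Ehresmann balls) and `u ∈ B`:
if `u` is a limit of points `u' ∈ B` with `ξ|_{𝒳_{u'}} ∈ Fʳ`, then `ξ|_{𝒳_u} ∈ Fʳ`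
(`isInHodgeFiltration_fiberRestrict_of_mem_closure_of_griffiths1968`), GRANTED the named fact
`Griffiths1968_holomorphicHodgeSubbundles` (Voisin I Thm. 10.3 in subbundle-frame form). Proof: near `u`,
inside a chart, a graded holomorphic frame `e(s)` of `Hᵏ(X_u; ℚ) ⊗ ℂ` adapted to the transported Hodge
flags (`exists_holomorphicFrame_of_subbundleFrames`); `ξ|_{X_s}` is the transport of `ξ|_{X_u}`
(`transportFun_fiberRestrict`), i.e. the fixed vector `y₀ = Θ⁻¹(ξ|_{X_u})` read through the rational
transport (`ofRatClassBaseChange_baseChange_eq_transportFun`), so `ξ|_{X_s} ∈ Fʳ` iff the coordinates of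
`y₀` of degree `< r` in `e(s)` vanish (`isInHodgeFiltration_iff_symm_mem_hodgeStructure_F`); these are
CONTINUOUS functions of `s` near `u`, so the condition passes to the limit `u`. On a CURVE (`d = 1`) they
are holomorphic functions of one chart parameter, whence the dichotomy «accumulating ⇒ a neighbourhood»
(`eventually_isInHodgeFiltration_fiberRestrict_of_frequently_of_griffiths1968`, identity theorem; the Dwork
pencil instance is `DworkSextic.Voisin2002_dworkPencil_hodgeFiltrationTwo_locus_dichotomy_of_griffiths1968`).
Both statements hold for EVERY relative dimension `n`, degree `k` and level `r` (e.g. for the fibre-square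
family of a smooth projective family of surfaces, `k = 4`, `r = 2`: the locus where a flat class of
`H² ⊗ H² ⊂ H⁴(S_b × S_b)` is of type `(2,2)` is closed — the analytic half of the base of an RM component).

Consumer: the hypothesis `hcl` (Lemma 5.13 for the universal family of hypersurfaces) of
`UniversalHypersurface.exists_forall_isIntegralClass_imp_eq_zero_of_climb_of_closed`
(`UniversalHypersurfaceHodgeLoci`), hence of the barrier reduction
`Voisin2003_generalHypersurface_noIntegralClassInF_of_climb_of_closed` — discharged from the general fact in
`UniversalHypersurfaceHodgeLociOfGriffiths`. Seat hodge-nonav 20241-p1 g12.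

## References

* [VoisinHodgeII2003] C. Voisin, Hodge Theory and Complex Algebraic Geometry II, CUP (2003), §5.3.1
  Def. 5.12 and Lemma 5.13.
* [VoisinHodgeI2002] C. Voisin, Hodge Theory and Complex Algebraic Geometry I, CUP (2002), §9.2.1,
  §10.2.1 Thm. 10.3.
-/

noncomputable section

open _root_.Topology _root_.Filter
open scoped TensorProduct

namespace Literature.AlgebraicGeometry.HodgeTheory

section HodgeTheory

open CategoryTheory
open Literature.AlgebraicTopology.SingularHomology Literature.AlgebraicGeometry.Motives

/-- Membership in the span of the basis vectors of degree `≥ r` is the vanishing of the coordinates of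
degree `< r`. [folklore] -/
private theorem mem_span_image_deg_iff' {N : ℕ} {V : Type*} [AddCommGroup V] [Module ℂ V]
    (e : Module.Basis (Fin N) ℂ V) (deg : Fin N → ℤ) (r : ℤ) (y : V) :
    y ∈ Submodule.span ℂ (e '' {σ | r ≤ deg σ}) ↔ ∀ σ, deg σ < r → e.repr y σ = 0 := by
  rw [Module.Basis.mem_span_image]
  constructor
  · intro h σ hσ
    by_contra hne
    exact not_le.mpr hσ (h (Finsupp.mem_support_iff.mpr hne))
  · intro h σ hσ
    by_contra hlt
    exact Finsupp.mem_support_iff.mp hσ (h σ (not_le.mp hlt))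

/-- **Voisin II Lemma 5.13 from Griffiths' theorem: the locus `{s : ξ|_{𝒳_s} ∈ Fʳ}` of a tube class is
CLOSED** (module docstring). For a smooth projective family `f : 𝒳 → S` of relative dimension `n` over a
smooth quasi-projective `ℂ`-scheme `S` of dimension `d`, an open `B ⊆ S(ℂ)`, a tube class
`ξ ∈ Hᵏ(f⁻¹B(ℂ); ℂ)`, `r : ℕ` and `u ∈ B` in the closure of `{u' ∈ B | ξ|_{𝒳_{u'}} ∈ FʳHᵏ(𝒳_{u'})}`:
`ξ|_{𝒳_u} ∈ FʳHᵏ(𝒳_u)`, granted `Griffiths1968_holomorphicHodgeSubbundles`.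
[cite: VoisinHodgeII2003, §5.3.1 Def. 5.12 and Lemma 5.13] [cite: VoisinHodgeI2002, §10.2.1 Thm. 10.3 and §9.2.1] -/
theorem isInHodgeFiltration_fiberRestrict_of_mem_closure_of_griffiths1968
    (hG : Griffiths1968_holomorphicHodgeSubbundles)
    {𝒳 S : SchemeOver ℂ} (f : 𝒳 ⟶ S) (n k d : ℕ) (hf : IsSmoothProjectiveFamily f n)
    (hS : IsQuasiProjectiveOver S) [AlgebraicGeometry.SmoothOfRelativeDimension d S.hom]
    {B : Set (ComplexPoints S)} (hBo : IsOpen B) (ξ : singularCohomology ℂ ℂ (tubeOver f B) k) (r : ℕ)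
    {u : ComplexPoints S} (huB : u ∈ B)
    (hcl : u ∈ closure {u' | ∃ hu' : u' ∈ B, IsInHodgeFiltration n (fiberOver f u') k r (fiberRestrict f hu' k ξ)}) :
    IsInHodgeFiltration n (fiberOver f u) k r (fiberRestrict f huB k ξ) := by
  classical
  -- the family data
  have hU : IsCohomologicallyLocallyTrivialOn f (Set.univ : Set (ComplexPoints S)) :=
    isCohomologicallyLocallyTrivialOn_univ_of_isSmoothProjectiveFamily f d hf hS
  let A : ∀ s : ComplexPoints S, HodgeModel n (fiberOver f s) := fun s ↦
    (exists_isReal_hodgeModel_holds n _ (hf.isSmoothProjective s)).choose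
  have hA : ∀ s, (A s).IsHodgeSymmetric := fun s ↦
    (exists_isReal_hodgeModel_holds n _ (hf.isSmoothProjective s)).choose_spec.isHodgeSymmetric
  haveI : ∀ s : ComplexPoints S, Module.Finite ℚ (singularCohomology ℚ ℚ (ComplexPoints (fiberOver f s)) k) :=
    fun s ↦ finite_singularCohomology_rat_complexPoints (hf.isSmoothProjective s) _
  haveI : HodgeTensorFacts.{0, 0} := Motives.hodgeTensorFacts_holds.{0, 0}
  -- topology of `S(ℂ)`: a manifold, hence locally path connected
  haveI : AlgebraicGeometry.LocallyOfFiniteType S.hom := hS.locallyOfFiniteType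
  haveI : AlgebraicGeometry.IsSeparated S.hom := hS.isVarietyPair_ofScheme.isSeparated
  haveI : T2Space (ComplexPoints S) := Literature.NumberTheory.Transcendental.t2Space_algPoints_holds _ ℂ
  letI := Motives.ComplexPoints.chartedSpace S d
  haveI : LocallyPathConnectedSpace (ComplexPoints S) :=
    ChartedSpace.locallyPathConnectedSpace (EuclideanSpace ℝ (Fin (2 * d))) _
  haveI : LocallyPathConnectedSpace (Set.univ : Set (ComplexPoints S)) := isOpen_univ.locallyPathConnectedSpace
  have hrat : ∀ (x y : (Set.univ : Set (ComplexPoints S))) (γ : Path.Homotopic.Quotient x y)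
      (α : complexBetti (fiberOver f x.1) k), IsRationalClass α → IsRationalClass (transportFun f k hU γ α) :=
    fun x y γ α hα ↦ isRationalClass_transportFun_of_isSmoothProjectiveFamily f k d hf hS γ hα
  -- the point `u` as a point of the subtype `univ`, and the neighbourhood `B`
  set t₁ : (Set.univ : Set (ComplexPoints S)) := ⟨u, Set.mem_univ u⟩ with ht₁
  set N : Set (Set.univ : Set (ComplexPoints S)) := {v | v.1 ∈ B} with hNdef
  have hN : N ∈ 𝓝 t₁ := (hBo.preimage continuous_subtype_val).mem_nhds (by exact huB)
  -- Griffiths' frames around `u`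
  obtain ⟨W₀, hW₀o, ht₁W₀, hW₀N, hW₀pc, ψ, hW₀ψ, hfr⟩ := hG f n k d hf hS hU A hA t₁ t₁ N hN
  set T₁ : singularCohomology ℚ ℚ (ComplexPoints (fiberOver f t₁.1)) k ≃ₗ[ℚ]
      singularCohomology ℚ ℚ (ComplexPoints (fiberOver f t₁.1)) k := LinearEquiv.refl ℚ _ with hT₁def
  have hT₁ : ∃ δ₁ : Path.Homotopic.Quotient t₁ t₁,
      ∀ v, ofRatClass _ k (T₁ v) = transportFun f k hU δ₁ (ofRatClass _ k v) :=
    ⟨Path.Homotopic.Quotient.refl t₁, fun v ↦ by rw [transportFun_refl]; rfl⟩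
  choose rk w hw hwhol using hfr T₁ hT₁
  obtain ⟨W, hWo, ht₁W, hWW₀, hWpc, hW⟩ := exists_holomorphicFrame_of_subbundleFrames f k hU t₁ hrat
    (fun v ↦ (A v.1).hodgeStructure (hf.isSmoothProjective v.1) (hA v.1) k) hW₀o hW₀pc ψ hW₀ψ
    ht₁W₀ hT₁ rk w hw hwhol
  obtain ⟨N', deg, e, hflag, -, hcoord⟩ := hW t₁ ht₁W T₁ hT₁
  have hWψ : W ⊆ ψ.source := hWW₀.trans hW₀ψ
  have hWB : ∀ v ∈ W, v.1 ∈ B := fun v hv ↦ hW₀N (hWW₀ hv)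
  -- the fixed vector `y₀ = Θ⁻¹(ξ|_{X_u})`
  set y₀ : ℂ ⊗[ℚ] singularCohomology ℚ ℚ (ComplexPoints (fiberOver f t₁.1)) k :=
    (ofRatClassBaseChangeEquiv (hf.isSmoothProjective u) k).symm (fiberRestrict f huB k ξ) with hy₀
  -- KEY: over `W`, `ξ|_{X_v} ∈ Fʳ` iff the coordinates of `y₀` of degree `< r` in `e(v)` vanish
  have hkey : ∀ (v : (Set.univ : Set (ComplexPoints S))) (hv : v ∈ W),
      IsInHodgeFiltration n (fiberOver f v.1) k r (fiberRestrict f (hWB v hv) k ξ) ↔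
        ∀ σ, deg σ < r → (e v).repr y₀ σ = 0 := by
    intro v hv
    obtain ⟨ε, hεW⟩ : ∃ ε : Path t₁ v, ∀ r', ε r' ∈ W :=
      ⟨(hWpc.joinedIn t₁ ht₁W v hv).somePath, (hWpc.joinedIn t₁ ht₁W v hv).somePath_mem⟩
    obtain ⟨T, hT⟩ := exists_ratTransport f k hU hrat (⟦ε⟧ : Path.Homotopic.Quotient t₁ v)
    have hT' : ∀ x, ofRatClass _ k (T x) = transportFun f k hU ⟦ε⟧ (ofRatClass _ k (T₁ x)) := fun x ↦ hT x
    have hF := hflag v hv ε hεW T hT' r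
    have hflat : ofRatClassBaseChangeEquiv (hf.isSmoothProjective v.1) k (T.toLinearMap.baseChange ℂ y₀) =
        fiberRestrict f (hWB v hv) k ξ := by
      rw [ofRatClassBaseChangeEquiv_apply, ofRatClassBaseChange_baseChange_eq_transportFun f k hU
        ⟦ε⟧ T hT y₀, hy₀, ← ofRatClassBaseChangeEquiv_apply (hf.isSmoothProjective u) k,
        LinearEquiv.apply_symm_apply]
      exact transportFun_fiberRestrict f k hU hBo ε (fun r' ↦ hWB _ (hεW r')) huB (hWB v hv) ξ
    rw [isInHodgeFiltration_iff_symm_mem_hodgeStructure_F (hf.isSmoothProjective v.1) (A v.1) (hA v.1),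
      ← mem_span_image_deg_iff' (e v) deg r y₀, ← hF, Motives.HodgeStructure.comapEquiv_F, Submodule.mem_comap,
      ← hflat, LinearEquiv.symm_apply_apply]
  -- `W` read in `S(ℂ)` and the continuity of the coordinates near `u`
  set V : Set (ComplexPoints S) :=
    {p | (⟨p, Set.mem_univ p⟩ : (Set.univ : Set (ComplexPoints S))) ∈ W} with hVdef
  have hmk : Continuous fun p : ComplexPoints S ↦ (⟨p, Set.mem_univ p⟩ : (Set.univ : Set (ComplexPoints S))) :=
    continuous_id.subtype_mk _
  have hVo : IsOpen V := hWo.preimage hmk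
  have huV : u ∈ V := ht₁W
  let c : Fin N' → ComplexPoints S → ℂ := fun σ p ↦ (e ⟨p, Set.mem_univ p⟩).repr y₀ σ
  have hc : ∀ σ, ContinuousOn (c σ) V := by
    intro σ
    have h1 : ContinuousOn (fun z ↦ (e (ψ.symm z)).repr y₀ σ) (ψ '' W) := (hcoord σ y₀).continuousOn
    have h2 : ContinuousOn (fun p : ComplexPoints S ↦ ψ ⟨p, Set.mem_univ p⟩) V :=
      fun p hp ↦ ((ψ.continuousAt (hWψ hp)).comp hmk.continuousAt).continuousWithinAt
    have h3 : Set.MapsTo (fun p : ComplexPoints S ↦ ψ ⟨p, Set.mem_univ p⟩) V (ψ '' W) :=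
      fun p hp ↦ ⟨_, hp, rfl⟩
    refine (h1.comp h2 h3).congr fun p hp ↦ ?_
    show (e ⟨p, Set.mem_univ p⟩).repr y₀ σ = (e (ψ.symm (ψ ⟨p, Set.mem_univ p⟩))).repr y₀ σ
    rw [ψ.left_inv (hWψ hp)]
  -- the locus near `u` is the common zero set of the coordinates of degree `< r`; pass to the limit
  refine (hkey t₁ ht₁W).mpr fun σ hσ ↦ ?_
  have hZ : {u' | ∃ hu' : u' ∈ B, IsInHodgeFiltration n (fiberOver f u') k r (fiberRestrict f hu' k ξ)} ∩ V ⊆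
      {p | c σ p = 0} := by
    rintro p ⟨⟨hpB, hpF⟩, hpV⟩
    exact (hkey ⟨p, Set.mem_univ p⟩ hpV).mp hpF σ hσ
  have hucl : u ∈ closure ({u' | ∃ hu' : u' ∈ B,
      IsInHodgeFiltration n (fiberOver f u') k r (fiberRestrict f hu' k ξ)} ∩ V) :=
    hVo.closure_inter ⟨hcl, huV⟩
  have hcu : c σ u ∈ closure (c σ '' ({u' | ∃ hu' : u' ∈ B,
      IsInHodgeFiltration n (fiberOver f u') k r (fiberRestrict f hu' k ξ)} ∩ V)) :=
    (((hc σ).continuousAt (hVo.mem_nhds huV)).continuousWithinAt).mem_closure_image hucl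
  have hsub : c σ '' ({u' | ∃ hu' : u' ∈ B,
      IsInHodgeFiltration n (fiberOver f u') k r (fiberRestrict f hu' k ξ)} ∩ V) ⊆ {0} := by
    rintro _ ⟨p, hp, rfl⟩
    exact hZ hp
  have h0 : c σ u ∈ ({0} : Set ℂ) :=
    (closure_minimal hsub isClosed_singleton) hcu
  exact h0


/-- **On a CURVE the locus `{s : ξ|_{𝒳_s} ∈ Fʳ}` is, near each point, either a neighbourhood or discrete**
(Voisin II Lemma 5.13 + the identity theorem in one variable): for a smooth projective family `f : 𝒳 → S`
over a smooth quasi-projective CURVE `S` (`SmoothOfRelativeDimension 1`), an open `B ⊆ S(ℂ)`, a tube class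
`ξ` and `u ∈ B`: if the set of `u' ∈ B` with `ξ|_{𝒳_{u'}} ∈ Fʳ` accumulates at `u`, then it contains a
neighbourhood of `u` — granted `Griffiths1968_holomorphicHodgeSubbundles` (the coordinates of degree `< r`
of the fixed flat vector in a graded holomorphic frame are holomorphic functions of the chart parameter;
`AnalyticOnNhd.eqOn_zero_of_preconnected_of_frequently_eq_zero`). The Dwork pencil case is
`DworkSextic.Voisin2002_dworkPencil_hodgeFiltrationTwo_locus_dichotomy_of_griffiths1968`.
[cite: VoisinHodgeII2003, §5.3.1 Lemma 5.13] [cite: VoisinHodgeI2002, §10.2.1 Thm. 10.3 and §9.2.1] -/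
theorem eventually_isInHodgeFiltration_fiberRestrict_of_frequently_of_griffiths1968
    (hG : Griffiths1968_holomorphicHodgeSubbundles)
    {𝒳 S : SchemeOver ℂ} (f : 𝒳 ⟶ S) (n k : ℕ) (hf : IsSmoothProjectiveFamily f n)
    (hS : IsQuasiProjectiveOver S) [AlgebraicGeometry.SmoothOfRelativeDimension 1 S.hom]
    {B : Set (ComplexPoints S)} (hBo : IsOpen B) (ξ : singularCohomology ℂ ℂ (tubeOver f B) k) (r : ℕ)
    {u : ComplexPoints S} (huB : u ∈ B)
    (hfreq : ∃ᶠ u' in 𝓝[≠] u, ∃ hu' : u' ∈ B,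
      IsInHodgeFiltration n (fiberOver f u') k r (fiberRestrict f hu' k ξ)) :
    ∀ᶠ u' in 𝓝 u, ∃ hu' : u' ∈ B, IsInHodgeFiltration n (fiberOver f u') k r (fiberRestrict f hu' k ξ) := by
  classical
  -- the family data
  have hU : IsCohomologicallyLocallyTrivialOn f (Set.univ : Set (ComplexPoints S)) :=
    isCohomologicallyLocallyTrivialOn_univ_of_isSmoothProjectiveFamily f 1 hf hS
  let A : ∀ s : ComplexPoints S, HodgeModel n (fiberOver f s) := fun s ↦
    (exists_isReal_hodgeModel_holds n _ (hf.isSmoothProjective s)).choose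
  have hA : ∀ s, (A s).IsHodgeSymmetric := fun s ↦
    (exists_isReal_hodgeModel_holds n _ (hf.isSmoothProjective s)).choose_spec.isHodgeSymmetric
  haveI : ∀ s : ComplexPoints S, Module.Finite ℚ (singularCohomology ℚ ℚ (ComplexPoints (fiberOver f s)) k) :=
    fun s ↦ finite_singularCohomology_rat_complexPoints (hf.isSmoothProjective s) _
  haveI : HodgeTensorFacts.{0, 0} := Motives.hodgeTensorFacts_holds.{0, 0}
  -- topology of `S(ℂ)`
  haveI : AlgebraicGeometry.LocallyOfFiniteType S.hom := hS.locallyOfFiniteType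
  haveI : AlgebraicGeometry.IsSeparated S.hom := hS.isVarietyPair_ofScheme.isSeparated
  haveI : T2Space (ComplexPoints S) := Literature.NumberTheory.Transcendental.t2Space_algPoints_holds _ ℂ
  letI := Motives.ComplexPoints.chartedSpace S 1
  haveI : LocallyPathConnectedSpace (ComplexPoints S) :=
    ChartedSpace.locallyPathConnectedSpace (EuclideanSpace ℝ (Fin (2 * 1))) _
  haveI : LocallyPathConnectedSpace (Set.univ : Set (ComplexPoints S)) := isOpen_univ.locallyPathConnectedSpace
  have hrat : ∀ (x y : (Set.univ : Set (ComplexPoints S))) (γ : Path.Homotopic.Quotient x y)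
      (α : complexBetti (fiberOver f x.1) k), IsRationalClass α → IsRationalClass (transportFun f k hU γ α) :=
    fun x y γ α hα ↦ isRationalClass_transportFun_of_isSmoothProjectiveFamily f k 1 hf hS γ hα
  set t₁ : (Set.univ : Set (ComplexPoints S)) := ⟨u, Set.mem_univ u⟩ with ht₁
  set N : Set (Set.univ : Set (ComplexPoints S)) := {v | v.1 ∈ B} with hNdef
  have hN : N ∈ 𝓝 t₁ := (hBo.preimage continuous_subtype_val).mem_nhds (by exact huB)
  obtain ⟨W₀, hW₀o, ht₁W₀, hW₀N, hW₀pc, ψ, hW₀ψ, hfr⟩ := hG f n k 1 hf hS hU A hA t₁ t₁ N hN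
  set T₁ : singularCohomology ℚ ℚ (ComplexPoints (fiberOver f t₁.1)) k ≃ₗ[ℚ]
      singularCohomology ℚ ℚ (ComplexPoints (fiberOver f t₁.1)) k := LinearEquiv.refl ℚ _ with hT₁def
  have hT₁ : ∃ δ₁ : Path.Homotopic.Quotient t₁ t₁,
      ∀ v, ofRatClass _ k (T₁ v) = transportFun f k hU δ₁ (ofRatClass _ k v) :=
    ⟨Path.Homotopic.Quotient.refl t₁, fun v ↦ by rw [transportFun_refl]; rfl⟩
  choose rk w hw hwhol using hfr T₁ hT₁
  obtain ⟨W, hWo, ht₁W, hWW₀, hWpc, hW⟩ := exists_holomorphicFrame_of_subbundleFrames f k hU t₁ hrat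
    (fun v ↦ (A v.1).hodgeStructure (hf.isSmoothProjective v.1) (hA v.1) k) hW₀o hW₀pc ψ hW₀ψ
    ht₁W₀ hT₁ rk w hw hwhol
  obtain ⟨N', deg, e, hflag, -, hcoord⟩ := hW t₁ ht₁W T₁ hT₁
  have hWψ : W ⊆ ψ.source := hWW₀.trans hW₀ψ
  have hWB : ∀ v ∈ W, v.1 ∈ B := fun v hv ↦ hW₀N (hWW₀ hv)
  set y₀ : ℂ ⊗[ℚ] singularCohomology ℚ ℚ (ComplexPoints (fiberOver f t₁.1)) k :=
    (ofRatClassBaseChangeEquiv (hf.isSmoothProjective u) k).symm (fiberRestrict f huB k ξ) with hy₀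
  have hkey : ∀ (v : (Set.univ : Set (ComplexPoints S))) (hv : v ∈ W),
      IsInHodgeFiltration n (fiberOver f v.1) k r (fiberRestrict f (hWB v hv) k ξ) ↔
        ∀ σ, deg σ < r → (e v).repr y₀ σ = 0 := by
    intro v hv
    obtain ⟨ε, hεW⟩ : ∃ ε : Path t₁ v, ∀ r', ε r' ∈ W :=
      ⟨(hWpc.joinedIn t₁ ht₁W v hv).somePath, (hWpc.joinedIn t₁ ht₁W v hv).somePath_mem⟩
    obtain ⟨T, hT⟩ := exists_ratTransport f k hU hrat (⟦ε⟧ : Path.Homotopic.Quotient t₁ v)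
    have hT' : ∀ x, ofRatClass _ k (T x) = transportFun f k hU ⟦ε⟧ (ofRatClass _ k (T₁ x)) := fun x ↦ hT x
    have hF := hflag v hv ε hεW T hT' r
    have hflat : ofRatClassBaseChangeEquiv (hf.isSmoothProjective v.1) k (T.toLinearMap.baseChange ℂ y₀) =
        fiberRestrict f (hWB v hv) k ξ := by
      rw [ofRatClassBaseChangeEquiv_apply, ofRatClassBaseChange_baseChange_eq_transportFun f k hU
        ⟦ε⟧ T hT y₀, hy₀, ← ofRatClassBaseChangeEquiv_apply (hf.isSmoothProjective u) k,
        LinearEquiv.apply_symm_apply]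
      exact transportFun_fiberRestrict f k hU hBo ε (fun r' ↦ hWB _ (hεW r')) huB (hWB v hv) ξ
    rw [isInHodgeFiltration_iff_symm_mem_hodgeStructure_F (hf.isSmoothProjective v.1) (A v.1) (hA v.1),
      ← mem_span_image_deg_iff' (e v) deg r y₀, ← hF, Motives.HodgeStructure.comapEquiv_F, Submodule.mem_comap,
      ← hflat, LinearEquiv.symm_apply_apply]
  -- the chart read as a map to `ℂ`
  let Lz : ℂ →L[ℂ] (Fin 1 → ℂ) := ContinuousLinearMap.pi fun _ ↦ ContinuousLinearMap.id ℂ ℂ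
  have hLz : ∀ q : Fin 1 → ℂ, Lz (q 0) = q := fun q ↦ funext fun i ↦ by
    rw [Fin.fin_one_eq_zero i]; rfl
  let Φ : ComplexPoints S → ℂ := fun p ↦ ψ ⟨p, Set.mem_univ p⟩ 0
  have hΦψ : ∀ v : (Set.univ : Set (ComplexPoints S)), Lz (Φ v.1) = ψ v := fun v ↦ hLz (ψ v)
  let g : Fin N' → ℂ → ℂ := fun σ z ↦ (e (ψ.symm (Lz z))).repr y₀ σ
  have hΩo : IsOpen (Lz ⁻¹' (ψ '' W)) := (ψ.isOpen_image_of_subset_source hWo hWψ).preimage Lz.continuous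
  have hg : ∀ σ, AnalyticOnNhd ℂ (g σ) (Lz ⁻¹' (ψ '' W)) := fun σ ↦
    (hcoord σ y₀).comp (Lz.analyticOnNhd _) (Set.mapsTo_preimage Lz (ψ '' W))
  have hgΦ : ∀ v ∈ W, ∀ σ, g σ (Φ v.1) = (e v).repr y₀ σ := by
    intro v hv σ
    show (e (ψ.symm (Lz (Φ v.1)))).repr y₀ σ = (e v).repr y₀ σ
    rw [hΦψ v, ψ.left_inv (hWψ hv)]
  have hz₀ : Φ u ∈ Lz ⁻¹' (ψ '' W) := by
    show Lz (Φ t₁.1) ∈ ψ '' W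
    rw [hΦψ t₁]
    exact ⟨t₁, ht₁W, rfl⟩
  obtain ⟨ρ, hρ, hball⟩ := Metric.isOpen_iff.mp hΩo (Φ u) hz₀
  set V : Set (ComplexPoints S) :=
    {p | (⟨p, Set.mem_univ p⟩ : (Set.univ : Set (ComplexPoints S))) ∈ W} with hVdef
  have hmk : Continuous fun p : ComplexPoints S ↦ (⟨p, Set.mem_univ p⟩ : (Set.univ : Set (ComplexPoints S))) :=
    continuous_id.subtype_mk _
  have hVo : IsOpen V := hWo.preimage hmk
  have huV : u ∈ V := ht₁W
  have hΦc : ContinuousAt Φ u := by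
    have h1 : ContinuousAt (fun p : ComplexPoints S ↦ ψ ⟨p, Set.mem_univ p⟩) u :=
      ContinuousAt.comp (f := fun p : ComplexPoints S ↦ (⟨p, Set.mem_univ p⟩ : (Set.univ : Set (ComplexPoints S))))
        (g := ψ) (ψ.continuousAt (hWψ ht₁W)) hmk.continuousAt
    exact ContinuousAt.comp (f := fun p : ComplexPoints S ↦ ψ ⟨p, Set.mem_univ p⟩)
      (g := fun q : Fin 1 → ℂ ↦ q 0) (continuous_apply (0 : Fin 1)).continuousAt h1
  have hinj : ∀ p ∈ V, Φ p = Φ u → p = u := by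
    intro p hpV h
    have h' : ψ ⟨p, Set.mem_univ p⟩ = ψ t₁ := by rw [← hΦψ ⟨p, Set.mem_univ p⟩, ← hΦψ t₁]; exact congrArg Lz h
    exact congrArg Subtype.val (ψ.injOn (hWψ hpV) (hWψ ht₁W) h')
  have hΦt : Tendsto Φ (𝓝[≠] u) (𝓝[≠] (Φ u)) := by
    refine tendsto_nhdsWithin_of_tendsto_nhds_of_eventually_within Φ
      (hΦc.tendsto.mono_left nhdsWithin_le_nhds) ?_
    filter_upwards [self_mem_nhdsWithin, mem_nhdsWithin_of_mem_nhds (hVo.mem_nhds huV)] with p hp hpV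
    exact fun h ↦ hp (hinj p hpV h)
  have hfreq' : ∃ᶠ p in 𝓝[≠] u, ∀ σ, deg σ < r → g σ (Φ p) = 0 := by
    refine (hfreq.and_eventually (mem_nhdsWithin_of_mem_nhds (hVo.mem_nhds huV))).mono ?_
    rintro p ⟨⟨hpB, hpF⟩, hpV⟩ σ hσ
    rw [hgΦ ⟨p, Set.mem_univ p⟩ hpV σ]
    exact (hkey ⟨p, Set.mem_univ p⟩ hpV).mp hpF σ hσ
  have hfreqC : ∃ᶠ z in 𝓝[≠] (Φ u), ∀ σ, deg σ < r → g σ z = 0 := hΦt.frequently hfreq'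
  have hvanish : ∀ σ, deg σ < r → Set.EqOn (g σ) 0 (Metric.ball (Φ u) ρ) := fun σ hσ ↦
    AnalyticOnNhd.eqOn_zero_of_preconnected_of_frequently_eq_zero ((hg σ).mono hball)
      (convex_ball (Φ u) ρ).isPreconnected (Metric.mem_ball_self hρ) (hfreqC.mono fun z hz ↦ hz σ hσ)
  have hnhds : {p | p ∈ V ∧ Φ p ∈ Metric.ball (Φ u) ρ} ∈ 𝓝 u :=
    Filter.inter_mem (hVo.mem_nhds huV)
      (hΦc.preimage_mem_nhds (Metric.isOpen_ball.mem_nhds (Metric.mem_ball_self hρ)))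
  refine Filter.mem_of_superset hnhds ?_
  rintro p ⟨hpV, hpball⟩
  refine ⟨hWB _ hpV, (hkey ⟨p, Set.mem_univ p⟩ hpV).mpr fun σ hσ ↦ ?_⟩
  rw [← hgΦ ⟨p, Set.mem_univ p⟩ hpV σ]
  exact hvanish σ hσ hpball

end HodgeTheory

end Literature.AlgebraicGeometry.HodgeTheory

end
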